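import Literature.Topology.FourManifolds.GompfConjInvariance
import Literature.Topology.FourManifolds.SurgeredMappingTorus
import Literature.Topology.FourManifolds.StraighteningInvariance
import HarnessLib

/-!
# Straightened monodromies with product tubes, and the isotopy transport of glued mapping tori

Infrastructure for the framed form of Gompf's Theorem 2.1 (the named fact
`Literature.Topology.FourManifolds.gompf2010_framedTwist`, R. Gompf, *More Cappell–Shaneson
spheres are standard*, Algebr. Geom. Topol. 10 (2010)). Gompf's proof of Theorem 2.1 takes place
in the mapping torus `X_φ` of a diffeomorphism `φ` of `T³` which "restricts to the identity in a
neighborhood of some point `p`" (§2 ¶1), the surgery circle `C = ℝ × {p}` then carrying its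
*canonical* (product) framing; the Cappell–Shaneson case is reached by *straightening* the linear
monodromy near `0` along one of its two straightening classes (§4, Def. 4.1 and ¶2:
"`X^{τ·σ}_ψ = X^σ_φ`" for based-isotopic monodromies). The tree's concrete spheres
`gompfSphere A γ` instead keep the linear monodromy `torusDiffeomorph A` and twist the tube by the
path `γ`. This file supplies the two pieces of glue between the two descriptions that do not
depend on the choice of straightening:

* `Literature.Topology.FourManifolds.TubeTwistPair ψ` — a pair of twisting data
  (`Literature.Topology.FourManifolds.TubeTwist` of `SectionCircleNbhd.lean`) over the two
  cylinders, compatible with an arbitrary gluing diffeomorphism `ψ` of `T³`; the resulting tube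
  `P.tubeFun : 𝕊¹ × ℝ³ → MappingTorusGlued ψ`, an open smooth embedding
  (`TubeTwistPair.isSmoothEmbedding_tubeFun`) with zero section the section circle
  `P.secCircle` through `1 ∈ T³` (`TubeTwistPair.range_secCircle`), packaged as
  `P.circleNbhd : CircleNbhd (𝓡 4) P.secCircle`. This is the construction of
  `sectionCircleNbhd A γ` (`SectionCircleNbhd.lean`) with `torusDiffeomorph A`, `twistA`,
  `twistB` replaced by `ψ`, `P.DA`, `P.DB`; the proofs are the same.
* `Literature.Topology.FourManifolds.TubeTwist.const ε`,
  `Literature.Topology.FourManifolds.prodPair ψ ε` — the **product tube**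
  `(u, w) ↦ [expT (univBall 0 ε w), s]` of the section circle of `X_ψ` for a monodromy `ψ` that
  is the identity on `expT (B(0, ε))` (Gompf's canonical framing, §2 ¶1), and the surgered
  manifold `Literature.Topology.FourManifolds.prodSurgered ψ ε hε hψ`.
* `Literature.Topology.FourManifolds.isotopyTransport φ F` — for a diffeotopy `F` of `T³`, the
  **diffeomorphism `MappingTorusGlued φ ≅ MappingTorusGlued (φ ∘ F₁)`** descending from the
  re-gluing embeddings `isotopyTwistOne F`, `isotopyTwistTwo φ F` of
  `SurgeredMappingTorus.lean` (there used inside the predicate `IsSurgeredMappingTorusOf`), by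
  uniqueness of open gluings with witnesses (`IsOpenGluingWith.exists_diffeomorph_apply_eq`):
  `Θ [x, s] = [F_{λ s}⁻¹ x, s]` on the first cylinder. When `F` is based at `1` and `φ 1 = 1` it
  maps the section circle of `X_φ` onto that of `X_{φ ∘ F₁}`
  (`isotopyTransport_secCircle`), so that circle surgeries are transported along it
  (`CircleNbhd.nonempty_diffeomorph_surgered_map`, `GompfConjInvariance.lean`). This is the
  mapping-torus half of Gompf's "`X^{τ·σ}_ψ = X^σ_φ`" (§4 ¶2); the tube half (how `Θ` acts on a
  framed tube when the stages of `F` are linear near `1`) is the subject of the sequel.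

Everything here is proved; tags are `[folklore]` except where Gompf's text is quoted.

## References

* R. E. Gompf, *More Cappell–Shaneson spheres are standard*, Algebr. Geom. Topol. 10 (2010)
  1665–1681, doi:10.2140/agt.2010.10.1665 (arXiv:0908.1914): §2 ¶1 (the construction `X_φ`,
  `X^ε_φ`, canonical framing when `φ = id` near `p`), §4 Def. 4.1 and ¶2 (`X^{τ·σ}_ψ = X^σ_φ`).
  [GompfAGT2010]
* S. Cappell, J. Shaneson, *Some new four-manifolds*, Ann. of Math. 104 (1976), §2.
  [CappellShaneson1976]
-/

open scoped Manifold ContDiff Topology Real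
open Set Function Metric Filter OpenPartialHomeomorph

noncomputable section

namespace Literature.Topology.FourManifolds

universe u

/-- Local notation: `𝔼 n` is the model Euclidean space `EuclideanSpace ℝ (Fin n)`. -/
local notation "𝔼 " n:arg => EuclideanSpace ℝ (Fin n)

/-- Local notation: `𝕊 n` is the unit sphere in `EuclideanSpace ℝ (Fin (n + 1))`. -/
local notation "𝕊 " n:arg => (Metric.sphere (0 : EuclideanSpace ℝ (Fin (n + 1))) 1)

/-- Local notation: the model with corners `𝓣 = (𝓡 1).prod ((𝓡 1).prod (𝓡 1))` of `ThreeTorus`. -/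
local notation "𝓣" =>
  (ModelWithCorners.prod (𝓡 1) (ModelWithCorners.prod (𝓡 1) (𝓡 1)))

/-! ### The glued mapping torus of a diffeomorphism of `T³` and its gluing datum -/

section Torus

variable (ψ : ThreeTorus ≃ₘ⟮𝓣, 𝓣⟯ ThreeTorus)

/-- **The gluing datum of the mapping torus `X_ψ`** of a diffeomorphism `ψ` of `T³`, charts valued
in `ℝ⁴` (`csGlueData A` is the case `ψ = torusDiffeomorph A`). [folklore] -/
abbrev mtGlueData : SmoothGlueData (ModelWithCorners.prod 𝓣 𝓘(ℝ, ℝ)) (ModelWithCorners.prod 𝓣 𝓘(ℝ, ℝ))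
    (ThreeTorus × mappingTorusPieceOne) (ThreeTorus × mappingTorusPieceTwo) (𝔼 4) :=
  mappingTorusGlueData ψ linTorusModel

/-- **The mapping torus `X_ψ = T³ × ℝ / (x, s) ∼ (ψ x, s + 1)`** of a diffeomorphism `ψ` of `T³`
as a glued smooth 4-manifold (`CSTorus A` is the case `ψ = torusDiffeomorph A`; Gompf 2010, §2 ¶1,
with the tree's convention realising Gompf's `X_{ψ⁻¹}`). [cite: GompfAGT2010, §2 (definition of X_φ and X_φ^ε)] -/
abbrev MTorus : Type := MappingTorusGlued ψ linTorusModel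

end Torus

/-! ### Pairs of twisting data compatible with a monodromy -/

/-- **Twisting data for a tube around the section circle of `X_ψ`.** Two twisting data `DA`, `DB`
(smooth families of invertible matrices with a radius, `TubeTwist`) for the tubes
`(s, w) ↦ (texp_A s w, s)` over the cylinder `T³ × (0, 1)` and `(t, w) ↦ (texp_B t w, t)` over
`T³ × (1/2, 3/2)`, compatible with the gluing of `X_ψ`: equal on the identically glued overlap
`t = s ∈ (1/2, 1]`, and related by `ψ` on the monodromy overlap `t = s + 1 ∈ (1, 3/2)`. For
`ψ = torusDiffeomorph A` the data `twistA A γ`, `twistB A γ` of `SectionCircleNbhd.lean` form such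
a pair; for `ψ` equal to the identity near `1` two copies of a constant datum do (`prodPair`). [folklore] -/
structure TubeTwistPair (ψ : ThreeTorus → ThreeTorus) where
  /-- The twisting datum over the first cylinder. -/
  DA : TubeTwist
  /-- The twisting datum over the second cylinder. -/
  DB : TubeTwist
  /-- On the identically glued overlap the two tubes agree. -/
  texp_eq_of_le : ∀ t : ℝ, 1 / 2 < t → t ≤ 1 → ∀ w, DB.texp t w = DA.texp t w
  /-- On the monodromy overlap the second tube is the image of the first under `ψ`. -/
  texp_eq_apply : ∀ t : ℝ, 1 < t → t < 3 / 2 → ∀ w, DB.texp t w = ψ (DA.texp (t - 1) w)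

/-- The twisting data of `A ∈ SL(3, ℤ)` along `γ` form a pair for `torusDiffeomorph A`
(`texp_twistA_of_le`, `texp_twistB_of_le`, `texp_twistB`). [folklore] -/
def twistPair (A : Matrix.SpecialLinearGroup (Fin 3) ℤ) (γ : SmoothMatrixPath (slRealMatrix A)) :
    TubeTwistPair (torusDiffeomorph A) where
  DA := twistA A γ
  DB := twistB A γ
  texp_eq_of_le t ht ht1 w := by
    rw [texp_twistB_of_le A γ ht1, texp_twistA_of_le A γ ht.le]
  texp_eq_apply t _ _ w := by
    rw [texp_twistB, coe_torusDiffeomorph]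

namespace TubeTwistPair

variable {ψ : ThreeTorus ≃ₘ⟮𝓣, 𝓣⟯ ThreeTorus} (P : TubeTwistPair ψ)

/-- **Compatibility of the two tubes with the gluing.** Away from `ptA` and `ptB` the two tubes
define the same point of the mapping torus: on the lower half circle (`angB = angA > 1/2`) both
agree, on the upper half circle (`angB = angA + 1`, `angA < 1/2`) the second is
`(ψ · texp_A, angA u + 1) ∼ (texp_A, angA u)`. [folklore] -/
theorem inl_tubeA_eq_inr_tubeB {u : 𝕊 1} (hA : u ≠ ptA) (hB : u ≠ ptB) (w : 𝔼 3) :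
    (mtGlueData ψ).inl (P.DA.tubeA (u, w)) = (mtGlueData ψ).inr (P.DB.tubeB (u, w)) := by
  rw [mappingTorusGlued_inl_eq_inr_iff, TubeTwist.tubeA_apply, TubeTwist.tubeB_apply, mappingTorusRel]
  dsimp only
  rw [coe_angAPt hA, coe_angBPt hB]
  rcases angB_eq_of_ne hA hB with ⟨hlt, h1⟩ | ⟨hgt, h0⟩
  · right
    refine ⟨h1, ?_⟩
    have h0 : 0 < angA u := (angA_mem_Ioc u).1
    rw [P.texp_eq_apply (angB u) (by linarith) (by linarith), h1, add_sub_cancel_right]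
  · left
    refine ⟨h0, ?_⟩
    rw [h0, P.texp_eq_of_le (angA u) hgt (angA_mem_Ioc u).2]

open scoped Classical in
/-- **The tube around the section circle** `𝕊¹ × ℝ³ → X_ψ`: `inl ∘ tubeA` off `ptA` and
`inr ∘ tubeB` at (hence near) `ptA`. [folklore] -/
def tubeFun (p : (𝕊 1) × 𝔼 3) : MTorus ψ :=
  if p.1 = ptA then (mtGlueData ψ).inr (P.DB.tubeB p)
  else (mtGlueData ψ).inl (P.DA.tubeA p)

/-- Off `ptA` the tube is `inl ∘ tubeA`. [folklore] -/
theorem tubeFun_of_ne {p : (𝕊 1) × 𝔼 3} (hp : p.1 ≠ ptA) :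
    P.tubeFun p = (mtGlueData ψ).inl (P.DA.tubeA p) := by
  rw [tubeFun, if_neg hp]

/-- Off `ptB` the tube is `inr ∘ tubeB`. [folklore] -/
theorem tubeFun_of_ne_ptB {p : (𝕊 1) × 𝔼 3} (hp : p.1 ≠ ptB) :
    P.tubeFun p = (mtGlueData ψ).inr (P.DB.tubeB p) := by
  by_cases h : p.1 = ptA
  · rw [tubeFun, if_pos h]
  · rw [P.tubeFun_of_ne h]
    exact P.inl_tubeA_eq_inr_tubeB h hp p.2

/-- Near a point off `ptA` the tube is `inl ∘ tubeA`. [folklore] -/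
theorem tubeFun_eventuallyEq_inl {p : (𝕊 1) × 𝔼 3} (hp : p.1 ≠ ptA) :
    P.tubeFun =ᶠ[𝓝 p] (mtGlueData ψ).inl ∘ P.DA.tubeA := by
  filter_upwards [(isOpen_ne_ptA.preimage continuous_fst).mem_nhds hp] with q hq
  exact P.tubeFun_of_ne hq

/-- Near a point off `ptB` the tube is `inr ∘ tubeB`. [folklore] -/
theorem tubeFun_eventuallyEq_inr {p : (𝕊 1) × 𝔼 3} (hp : p.1 ≠ ptB) :
    P.tubeFun =ᶠ[𝓝 p] (mtGlueData ψ).inr ∘ P.DB.tubeB := by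
  filter_upwards [(isOpen_ne_ptB.preimage continuous_fst).mem_nhds hp] with q hq
  exact P.tubeFun_of_ne_ptB hq

/-- **The tube is an immersion** at every point (with trivial complement), being locally
`inl ∘ tubeA` or `inr ∘ tubeB`. [folklore] -/
theorem isImmersionAtOfComplement_tubeFun (p : (𝕊 1) × 𝔼 3) :
    Manifold.IsImmersionAtOfComplement Unit ((𝓡 1).prod 𝓘(ℝ, 𝔼 3)) 𝓘(ℝ, 𝔼 4) ∞ P.tubeFun p := by
  rcases ne_ptA_or_ne_ptB p.1 with h | h
  · have h1 : Manifold.IsImmersionAtOfComplement Unit ((𝓡 1).prod 𝓘(ℝ, 𝔼 3))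
        (ModelWithCorners.prod 𝓣 𝓘(ℝ, ℝ)) ∞ P.DA.tubeA p :=
      isImmersionAtOfComplement_of_eventuallyEq_openPartialHomeomorph P.DA.tubeA
        P.DA.contMDiffOn_tubeA P.DA.contMDiffOn_tubeA_symm linTubeModel
        ((P.DA.mem_tubeA_source).2 h) EventuallyEq.rfl
    exact ((mtGlueData ψ).isImmersionAtOfComplement_inl_comp h1).congr_of_eventuallyEq
      (P.tubeFun_eventuallyEq_inl h).symm
  · have h1 : Manifold.IsImmersionAtOfComplement Unit ((𝓡 1).prod 𝓘(ℝ, 𝔼 3))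
        (ModelWithCorners.prod 𝓣 𝓘(ℝ, ℝ)) ∞ P.DB.tubeB p :=
      isImmersionAtOfComplement_of_eventuallyEq_openPartialHomeomorph P.DB.tubeB
        P.DB.contMDiffOn_tubeB P.DB.contMDiffOn_tubeB_symm linTubeModel
        ((P.DB.mem_tubeB_source).2 h) EventuallyEq.rfl
    exact ((mtGlueData ψ).isImmersionAtOfComplement_inr_comp h1).congr_of_eventuallyEq
      (P.tubeFun_eventuallyEq_inr h).symm

/-- The tube is an immersion. [folklore] -/
theorem isImmersion_tubeFun :
    Manifold.IsImmersion ((𝓡 1).prod 𝓘(ℝ, 𝔼 3)) 𝓘(ℝ, 𝔼 4) ∞ P.tubeFun :=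
  Manifold.IsImmersionOfComplement.isImmersion P.isImmersionAtOfComplement_tubeFun

/-- The tube is continuous. [folklore] -/
theorem continuous_tubeFun : Continuous P.tubeFun :=
  continuous_iff_continuousAt.2 fun p ↦ (P.isImmersionAtOfComplement_tubeFun p).continuousAt

/-- The fibre over `ptA` (level `1` in the second cylinder) does not meet the rest of the tube
(levels `angA u ∈ (0, 1)` in the first cylinder). [folklore] -/
theorem inl_tubeA_ne_inr_tubeB {p q : (𝕊 1) × 𝔼 3} (hp : p.1 ≠ ptA) (hq : q.1 = ptA) :
    (mtGlueData ψ).inl (P.DA.tubeA p) ≠ (mtGlueData ψ).inr (P.DB.tubeB q) := by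
  intro h
  rw [mappingTorusGlued_inl_eq_inr_iff, TubeTwist.tubeA_apply, TubeTwist.tubeB_apply,
    mappingTorusRel] at h
  dsimp only at h
  rw [hq, coe_angBPt_ptA, coe_angAPt hp] at h
  rcases h with ⟨h1, -⟩ | ⟨h1, -⟩
  · exact (angA_lt_one hp).ne h1.symm
  · linarith [(angA_mem_Ioc p.1).1]

/-- **The tube is injective.** [folklore] -/
theorem injective_tubeFun : Injective P.tubeFun := by
  intro p q hpq
  by_cases hp : p.1 = ptA <;> by_cases hq : q.1 = ptA
  · rw [tubeFun, if_pos hp, tubeFun, if_pos hq] at hpq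
    exact P.DB.tubeB.injOn ((P.DB.mem_tubeB_source).2 (hp ▸ ptA_ne_ptB))
      ((P.DB.mem_tubeB_source).2 (hq ▸ ptA_ne_ptB)) ((mtGlueData ψ).inr_injective hpq)
  · rw [tubeFun, if_pos hp, tubeFun, if_neg hq] at hpq
    exact absurd hpq.symm (P.inl_tubeA_ne_inr_tubeB hq hp)
  · rw [tubeFun, if_neg hp, tubeFun, if_pos hq] at hpq
    exact absurd hpq (P.inl_tubeA_ne_inr_tubeB hp hq)
  · rw [tubeFun, if_neg hp, tubeFun, if_neg hq] at hpq
    exact P.DA.tubeA.injOn ((P.DA.mem_tubeA_source).2 hp) ((P.DA.mem_tubeA_source).2 hq)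
      ((mtGlueData ψ).inl_injective hpq)

/-- **The tube is an open map**: locally an open partial homeomorphism followed by an open
embedding. [folklore] -/
theorem isOpenMap_tubeFun : IsOpenMap P.tubeFun := by
  refine isOpenMap_iff_nhds_le.2 fun p ↦ ?_
  rcases ne_ptA_or_ne_ptB p.1 with h | h
  · have hev := P.tubeFun_eventuallyEq_inl h
    rw [Filter.map_congr hev, ← Filter.map_map, P.DA.tubeA.map_nhds_eq ((P.DA.mem_tubeA_source).2 h),
      (mtGlueData ψ).isOpenEmbedding_inl.map_nhds_eq, hev.eq_of_nhds]
    exact le_rfl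
  · have hev := P.tubeFun_eventuallyEq_inr h
    rw [Filter.map_congr hev, ← Filter.map_map, P.DB.tubeB.map_nhds_eq ((P.DB.mem_tubeB_source).2 h),
      (mtGlueData ψ).isOpenEmbedding_inr.map_nhds_eq, hev.eq_of_nhds]
    exact le_rfl

/-- The tube is an open embedding. [folklore] -/
theorem isOpenEmbedding_tubeFun : Topology.IsOpenEmbedding P.tubeFun :=
  .of_continuous_injective_isOpenMap P.continuous_tubeFun P.injective_tubeFun P.isOpenMap_tubeFun

/-- **The tube is a smooth embedding** `𝕊¹ × ℝ³ ↪ X_ψ`. [folklore] -/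
theorem isSmoothEmbedding_tubeFun :
    Manifold.IsSmoothEmbedding ((𝓡 1).prod 𝓘(ℝ, 𝔼 3)) (𝓡 4) ∞ P.tubeFun :=
  ⟨P.isImmersion_tubeFun, P.isOpenEmbedding_tubeFun.isEmbedding⟩

/-- **The section circle** of `X_ψ` through `1 ∈ T³`, the zero section of the tube. [folklore] -/
def secCircle (u : 𝕊 1) : MTorus ψ := P.tubeFun (u, 0)

/-- Off `ptA`, `c u = inl (1, angA u)`. [folklore] -/
theorem secCircle_of_ne {u : 𝕊 1} (hu : u ≠ ptA) :
    P.secCircle u = (mtGlueData ψ).inl (1, angAPt u) := by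
  rw [secCircle, P.tubeFun_of_ne hu, TubeTwist.tubeA_apply, TubeTwist.texp_zero]

/-- Off `ptB`, `c u = inr (1, angB u)`. [folklore] -/
theorem secCircle_of_ne_ptB {u : 𝕊 1} (hu : u ≠ ptB) :
    P.secCircle u = (mtGlueData ψ).inr (1, angBPt u) := by
  rw [secCircle, P.tubeFun_of_ne_ptB hu, TubeTwist.tubeB_apply, TubeTwist.texp_zero]

/-- **The section circle does not depend on the twisting data** (it is the zero section
`[1, s]`). [folklore] -/
theorem secCircle_eq (P' : TubeTwistPair ψ) : P.secCircle = P'.secCircle := by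
  funext u
  rcases ne_ptA_or_ne_ptB u with h | h
  · rw [P.secCircle_of_ne h, P'.secCircle_of_ne h]
  · rw [P.secCircle_of_ne_ptB h, P'.secCircle_of_ne_ptB h]

/-- **The tubular neighbourhood of the section circle of `X_ψ`** defined by the pair `P`, as a
`CircleNbhd`. [folklore] -/
def circleNbhd : CircleNbhd (𝓡 4) P.secCircle where
  toFun := P.tubeFun
  isSmoothEmbedding := P.isSmoothEmbedding_tubeFun
  isOpen_range := P.isOpenMap_tubeFun.isOpen_range
  apply_zero _ := rfl

/-- The tube of the `CircleNbhd` is `tubeFun`. [folklore] -/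
@[simp] theorem circleNbhd_toFun : P.circleNbhd.toFun = P.tubeFun := rfl

/-- **The section circle is an immersion** with complement `ℝ³` at every point. [folklore] -/
theorem isImmersionAtOfComplement_secCircle (u : 𝕊 1) :
    Manifold.IsImmersionAtOfComplement (𝔼 3) (𝓡 1) 𝓘(ℝ, 𝔼 4) ∞ P.secCircle u := by
  rcases ne_ptA_or_ne_ptB u with h | h
  · have h1 : Manifold.IsImmersionAtOfComplement (𝔼 3) (𝓡 1) (ModelWithCorners.prod 𝓣 𝓘(ℝ, ℝ)) ∞
        (fun v ↦ P.DA.tubeA (v, 0)) u :=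
      isImmersionAtOfComplement_of_eventuallyEq_prod P.DA.tubeA P.DA.contMDiffOn_tubeA
        P.DA.contMDiffOn_tubeA_symm linTubeModel ((P.DA.mem_tubeA_source).2 h) EventuallyEq.rfl
    refine ((mtGlueData ψ).isImmersionAtOfComplement_inl_comp h1).congr_of_eventuallyEq ?_
    filter_upwards [isOpen_ne_ptA.mem_nhds h] with v hv
    exact (P.tubeFun_of_ne (p := (v, 0)) hv).symm
  · have h1 : Manifold.IsImmersionAtOfComplement (𝔼 3) (𝓡 1) (ModelWithCorners.prod 𝓣 𝓘(ℝ, ℝ)) ∞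
        (fun v ↦ P.DB.tubeB (v, 0)) u :=
      isImmersionAtOfComplement_of_eventuallyEq_prod P.DB.tubeB P.DB.contMDiffOn_tubeB
        P.DB.contMDiffOn_tubeB_symm linTubeModel ((P.DB.mem_tubeB_source).2 h) EventuallyEq.rfl
    refine ((mtGlueData ψ).isImmersionAtOfComplement_inr_comp h1).congr_of_eventuallyEq ?_
    filter_upwards [isOpen_ne_ptB.mem_nhds h] with v hv
    exact (P.tubeFun_of_ne_ptB (p := (v, 0)) hv).symm

/-- The section circle is continuous. [folklore] -/
theorem continuous_secCircle : Continuous P.secCircle :=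
  P.continuous_tubeFun.comp (continuous_id.prodMk continuous_const)

/-- The section circle is injective. [folklore] -/
theorem injective_secCircle : Injective P.secCircle := fun _ _ h ↦
  congrArg Prod.fst (P.injective_tubeFun h)

/-- **The section circle is a smoothly embedded circle** in `X_ψ`. [folklore] -/
theorem isSmoothEmbedding_secCircle :
    Manifold.IsSmoothEmbedding (𝓡 1) (𝓡 4) ∞ P.secCircle :=
  ⟨Manifold.IsImmersionOfComplement.isImmersion P.isImmersionAtOfComplement_secCircle,
    (P.continuous_secCircle.isClosedEmbedding P.injective_secCircle).isEmbedding⟩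

/-- **The image of the section circle** is `inl ({1} × (0, 1)) ∪ inr ({1} × (1/2, 3/2))`. [folklore] -/
theorem range_secCircle : range P.secCircle =
    (mtGlueData ψ).inl '' ({1} ×ˢ univ) ∪ (mtGlueData ψ).inr '' ({1} ×ˢ univ) := by
  apply Subset.antisymm
  · rintro _ ⟨u, rfl⟩
    rcases ne_ptA_or_ne_ptB u with h | h
    · exact Or.inl ⟨(1, angAPt u), ⟨rfl, mem_univ _⟩, (P.secCircle_of_ne h).symm⟩
    · exact Or.inr ⟨(1, angBPt u), ⟨rfl, mem_univ _⟩, (P.secCircle_of_ne_ptB h).symm⟩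
  · rintro _ (⟨⟨z, s⟩, ⟨hz, -⟩, rfl⟩ | ⟨⟨z, t⟩, ⟨hz, -⟩, rfl⟩)
    · rw [mem_singleton_iff] at hz
      subst hz
      refine ⟨circlePt s, ?_⟩
      rw [P.secCircle_of_ne (circlePt_ne_ptA s)]
      congr 2
      exact angleChartA.right_inv (mem_univ s)
    · rw [mem_singleton_iff] at hz
      subst hz
      refine ⟨circlePt t, ?_⟩
      rw [P.secCircle_of_ne_ptB (circlePt_ne_ptB t)]
      congr 2
      exact angleChartB.right_inv (mem_univ t)

/-- The tree's `secNbhdFun A γ` is the tube of the pair `twistPair A γ` (same formula). [folklore] -/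
theorem tubeFun_twistPair (A : Matrix.SpecialLinearGroup (Fin 3) ℤ)
    (γ : SmoothMatrixPath (slRealMatrix A)) : (twistPair A γ).tubeFun = secNbhdFun A γ := by
  funext p
  by_cases hp : p.1 = ptA
  · rw [tubeFun, if_pos hp, secNbhdFun, if_pos hp]
    rfl
  · rw [tubeFun, if_neg hp, secNbhdFun, if_neg hp]
    rfl

/-- The section circle of the pair `twistPair A γ` is the tree's `sectionCircle A γ`. [folklore] -/
theorem secCircle_twistPair (A : Matrix.SpecialLinearGroup (Fin 3) ℤ)
    (γ : SmoothMatrixPath (slRealMatrix A)) : (twistPair A γ).secCircle = sectionCircle A γ := by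
  funext u
  show (twistPair A γ).tubeFun (u, 0) = secNbhdFun A γ (u, 0)
  rw [tubeFun_twistPair]

end TubeTwistPair

/-! ### The product tube of a monodromy which is the identity near `1` -/

section Prod

/-- For `v` in the ball of radius `ε ≤ π` every coordinate lies in `(-π, π)`. [folklore] -/
theorem abs_apply_lt_pi_of_norm_lt {ε : ℝ} (hε : ε ≤ π) {v : 𝔼 3} (hv : ‖v‖ < ε) (i : Fin 3) :
    |v i| < π := by
  have h1 : |v i| ≤ ‖v‖ := (Real.norm_eq_abs _).symm.le.trans (PiLp.norm_apply_le v i)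
  linarith

/-- **The constant twisting datum** of radius `ε ∈ (0, π]`: matrices identically `1`, so that the
tube is the *product* tube `(s, w) ↦ (expT (univBall 0 ε w), s)` (Gompf's canonical framing of
the surgery circle when the monodromy is the identity near the base point, §2 ¶1). [cite: GompfAGT2010, §2 (definition of X_φ and X_φ^ε)] -/
def TubeTwist.const (ε : ℝ) (hε : 0 < ε) (hεπ : ε ≤ π) : TubeTwist where
  ε := ε
  ε_pos := hε
  mat _ := 1
  inv _ := 1
  contDiff_mat _ _ := contDiff_const
  contDiff_inv _ _ := contDiff_const
  mat_mul_inv _ := Matrix.mul_one _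
  inv_mul_mat _ := Matrix.mul_one _
  abs_lt_pi _ v hv i := by
    rw [mulVecE_one]
    exact abs_apply_lt_pi_of_norm_lt hεπ hv i

/-- The twisted exponential of the constant datum is `expT ∘ univBall 0 ε`, independent of the
level. [folklore] -/
theorem TubeTwist.texp_const {ε : ℝ} (hε : 0 < ε) (hεπ : ε ≤ π) (s : ℝ) (w : 𝔼 3) :
    (TubeTwist.const ε hε hεπ).texp s w = expT ((TubeTwist.const ε hε hεπ).shrink w) := by
  rw [TubeTwist.texp]
  exact congrArg expT (mulVecE_one _)

/-- The shrunk vector of the constant datum lies in the `ε`-ball. [folklore] -/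
theorem TubeTwist.norm_shrink_const_lt {ε : ℝ} (hε : 0 < ε) (hεπ : ε ≤ π) (w : 𝔼 3) :
    ‖(TubeTwist.const ε hε hεπ).shrink w‖ < ε :=
  (TubeTwist.const ε hε hεπ).norm_shrink_lt w

variable (ψ : ThreeTorus ≃ₘ⟮𝓣, 𝓣⟯ ThreeTorus) (ε : ℝ) (hε : 0 < ε) (hεπ : ε ≤ π)

/-- **The product pair** for a monodromy `ψ` which is the identity on `expT (B(0, ε))`: two copies
of the constant datum (Gompf 2010, §2 ¶1: "we may assume `φ` restricts to the identity in a
neighborhood of some point `p` … Then `ℝ × {p}` descends to a circle `C ⊂ X_φ` with a canonical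
framing"). [cite: GompfAGT2010, §2 (definition of X_φ and X_φ^ε)] -/
def prodPair (hψ : ∀ v : 𝔼 3, ‖v‖ < ε → ψ (expT v) = expT v) : TubeTwistPair ψ where
  DA := TubeTwist.const ε hε hεπ
  DB := TubeTwist.const ε hε hεπ
  texp_eq_of_le _ _ _ _ := rfl
  texp_eq_apply t _ _ w := by
    rw [TubeTwist.texp_const, TubeTwist.texp_const, hψ _ (TubeTwist.norm_shrink_const_lt hε hεπ w)]

variable (hψ : ∀ v : 𝔼 3, ‖v‖ < ε → ψ (expT v) = expT v)

/-- **The product tube** `(u, w) ↦ [expT (univBall 0 ε w), s]` of the section circle of `X_ψ`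
(the canonical framing). [cite: GompfAGT2010, §2 (definition of X_φ and X_φ^ε)] -/
abbrev prodTube : CircleNbhd (𝓡 4) (prodPair ψ ε hε hεπ hψ).secCircle :=
  (prodPair ψ ε hε hεπ hψ).circleNbhd

/-- The product tube off `ptA`: `[expT (univBall 0 ε w), angA u]` in the first cylinder. [folklore] -/
theorem prodTube_apply_of_ne {u : 𝕊 1} (hu : u ≠ ptA) (w : 𝔼 3) :
    (prodTube ψ ε hε hεπ hψ).toFun (u, w) =
      (mtGlueData ψ).inl (expT ((TubeTwist.const ε hε hεπ).shrink w), angAPt u) := by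
  rw [TubeTwistPair.circleNbhd_toFun, TubeTwistPair.tubeFun_of_ne _ hu, TubeTwist.tubeA_apply]
  exact congrArg (fun x ↦ (mtGlueData ψ).inl (x, angAPt u)) (TubeTwist.texp_const hε hεπ _ w)

/-- The product tube off `ptB`: `[expT (univBall 0 ε w), angB u]` in the second cylinder. [folklore] -/
theorem prodTube_apply_of_ne_ptB {u : 𝕊 1} (hu : u ≠ ptB) (w : 𝔼 3) :
    (prodTube ψ ε hε hεπ hψ).toFun (u, w) =
      (mtGlueData ψ).inr (expT ((TubeTwist.const ε hε hεπ).shrink w), angBPt u) := by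
  rw [TubeTwistPair.circleNbhd_toFun, TubeTwistPair.tubeFun_of_ne_ptB _ hu, TubeTwist.tubeB_apply]
  exact congrArg (fun x ↦ (mtGlueData ψ).inr (x, angBPt u)) (TubeTwist.texp_const hε hεπ _ w)

/-- **Gompf's `X^0_ψ` for a monodromy straightened near the base point**: the mapping torus of
`ψ` surgered along its section circle with the canonical (product) framing of radius `ε` — a
closed smooth 4-manifold (`CircleNbhd.Surgered`, `CircleSurgeryExistence.lean`). Changing the
straightening class of `ψ` realises the other framing `X^1` (§4 ¶2: "Changing the framing is
equivalent to changing `σ`"). [cite: GompfAGT2010, §2 (definition of X_φ and X_φ^ε)] -/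
abbrev prodSurgered : Type := (prodTube ψ ε hε hεπ hψ).Surgered

end Prod

/-! ### The isotopy transport `X_φ ≅ X_{φ ∘ F₁}` -/

section Transport

variable (φ : ThreeTorus ≃ₘ⟮𝓣, 𝓣⟯ ThreeTorus) (D : Diffeotopy 𝓣 ThreeTorus)

/-- **`X_φ` is an open gluing of the two cylinders along the relation of `φ ∘ F₁`**, for any
diffeotopy `F` of `T³`, with witnesses the canonical embeddings precomposed with the re-gluing
diffeomorphisms `isotopyTwistOne F`, `isotopyTwistTwo φ F` of `SurgeredMappingTorus.lean`
(`mappingTorusRel_isotopyTwist_iff`). [cite: GompfAGT2010, §2 (X_φ^ε depends on φ up to isotopy rel p)] -/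
theorem isOpenGluingWith_mTorus_isotopyTwist :
    IsOpenGluingWith (ModelWithCorners.prod 𝓣 𝓘(ℝ, ℝ)) (ModelWithCorners.prod 𝓣 𝓘(ℝ, ℝ)) (𝓡 4)
      (mappingTorusRel ⇑((D.stage 1).trans φ))
      ((mtGlueData φ).inl ∘ isotopyTwistOne D) ((mtGlueData φ).inr ∘ isotopyTwistTwo φ D) := by
  obtain ⟨hA, hAo, hB, hBo, hU, hR⟩ := isOpenGluingWith_mappingTorusGlued φ linTorusModel
  have hsA : Function.Surjective (isotopyTwistOne D) := (isotopyTwistOne D).surjective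
  have hsB : Function.Surjective (isotopyTwistTwo φ D) := (isotopyTwistTwo φ D).surjective
  refine ⟨hA.comp_diffeomorph _, ?_, hB.comp_diffeomorph _, ?_, ?_, fun a b ↦ ?_⟩
  · rwa [hsA.range_comp]
  · rwa [hsB.range_comp]
  · rwa [hsA.range_comp, hsB.range_comp]
  · rw [Function.comp_apply, Function.comp_apply, hR]
    exact mappingTorusRel_isotopyTwist_iff φ D a b

/-- **The isotopy transport exists**: a diffeomorphism `Θ : X_φ ≅ X_{φ ∘ F₁}` with
`Θ (inl (F_{λ s} x, s)) = inl (x, s)` and `Θ (inr (isotopyTwistTwo φ F b)) = inr b` (uniqueness of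
open gluings with witnesses). [cite: GompfAGT2010, §2 (X_φ^ε depends on φ up to isotopy rel p)] -/
theorem exists_isotopyTransport :
    ∃ Θ : MTorus φ ≃ₘ⟮𝓡 4, 𝓡 4⟯ MTorus ((D.stage 1).trans φ),
      (∀ a, Θ ((mtGlueData φ).inl (isotopyTwistOne D a)) = (mtGlueData ((D.stage 1).trans φ)).inl a) ∧
      (∀ b, Θ ((mtGlueData φ).inr (isotopyTwistTwo φ D b)) =
        (mtGlueData ((D.stage 1).trans φ)).inr b) :=
  (isOpenGluingWith_mTorus_isotopyTwist φ D).exists_diffeomorph_apply_eq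
    (isOpenGluingWith_mappingTorusGlued ((D.stage 1).trans φ) linTorusModel)

/-- **The isotopy transport `Θ_F : X_φ ≅ X_{φ ∘ F₁}`**, `[F_{λ s} x, s] ↦ [x, s]` on the first
cylinder: the monodromy `φ` is changed by the based isotopy `F` at the cost of re-gluing (Gompf
2010, §4 ¶2: an isotopy rel `p` between monodromies identifies the mapping tori, with the
straightening changing accordingly). [cite: GompfAGT2010, §4 ¶2 (X^{τ·σ}_ψ = X^σ_φ)] -/
def isotopyTransport : MTorus φ ≃ₘ⟮𝓡 4, 𝓡 4⟯ MTorus ((D.stage 1).trans φ) :=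
  (exists_isotopyTransport φ D).choose

/-- `Θ` on the (twisted) first cylinder. [folklore] -/
theorem isotopyTransport_inl_isotopyTwistOne (a : ThreeTorus × ↥mappingTorusPieceOne) :
    isotopyTransport φ D ((mtGlueData φ).inl (isotopyTwistOne D a)) =
      (mtGlueData ((D.stage 1).trans φ)).inl a :=
  (exists_isotopyTransport φ D).choose_spec.1 a

/-- `Θ` on the (twisted) second cylinder. [folklore] -/
theorem isotopyTransport_inr_isotopyTwistTwo (b : ThreeTorus × ↥mappingTorusPieceTwo) :
    isotopyTransport φ D ((mtGlueData φ).inr (isotopyTwistTwo φ D b)) =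
      (mtGlueData ((D.stage 1).trans φ)).inr b :=
  (exists_isotopyTransport φ D).choose_spec.2 b

/-- `Θ` on the first cylinder: `Θ [x, s] = [F_{λ s}⁻¹ x, s]`. [folklore] -/
theorem isotopyTransport_inl (x : ThreeTorus) (s : ↥mappingTorusPieceOne) :
    isotopyTransport φ D ((mtGlueData φ).inl (x, s)) =
      (mtGlueData ((D.stage 1).trans φ)).inl (D.invFun (isotopyProfile s) x, s) := by
  have h := isotopyTransport_inl_isotopyTwistOne φ D (D.invFun (isotopyProfile s) x, s)
  rwa [isotopyTwistOne_apply, D.toFun_invFun] at h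

/-- `Θ` on the second cylinder: `Θ [y, t] = [φ F_1 F_{λ(t-1)}⁻¹ φ⁻¹ y, t]`. [folklore] -/
theorem isotopyTransport_inr (y : ThreeTorus) (t : ↥mappingTorusPieceTwo) :
    isotopyTransport φ D ((mtGlueData φ).inr (y, t)) =
      (mtGlueData ((D.stage 1).trans φ)).inr
        (φ (D.toFun 1 (D.invFun (isotopyProfile (t - 1)) (φ.symm y))), t) := by
  have h := isotopyTransport_inr_isotopyTwistTwo φ D
    (φ (D.toFun 1 (D.invFun (isotopyProfile (t - 1)) (φ.symm y))), t)
  rwa [isotopyTwistTwo_apply, Diffeomorph.symm_apply_apply, D.invFun_toFun, D.toFun_invFun,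
    Diffeomorph.apply_symm_apply] at h

/-- **`Θ` maps the section circle onto the section circle** when the diffeotopy is based at `1`
and `φ 1 = 1` (both circles are `[1, s]`, and `F_t 1 = 1`). [cite: GompfAGT2010, §4 ¶2 (X^{τ·σ}_ψ = X^σ_φ)] -/
theorem isotopyTransport_comp_secCircle (hφ : φ 1 = 1) (hD : ∀ t, D.toFun t 1 = 1)
    (P : TubeTwistPair φ) (P' : TubeTwistPair ((D.stage 1).trans φ)) :
    ⇑(isotopyTransport φ D) ∘ P.secCircle = P'.secCircle := by
  have hD' : ∀ t, D.invFun t 1 = 1 := fun t ↦ by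
    conv_lhs => rw [← hD t]
    exact D.invFun_toFun t 1
  have hφ' : φ.symm 1 = 1 := φ.symm_apply_eq_self_of_apply_eq_self hφ
  funext u
  by_cases hu : u = ptA
  · subst hu
    rw [comp_apply, P.secCircle_of_ne_ptB ptA_ne_ptB, P'.secCircle_of_ne_ptB ptA_ne_ptB,
      isotopyTransport_inr, hφ', hD', hD, hφ]
  · rw [comp_apply, P.secCircle_of_ne hu, P'.secCircle_of_ne hu, isotopyTransport_inl, hD']

/-- **Transport of the surgery**: for any pair of twisting data `P` on `X_φ`, the surgery of
`X_φ` along `P`'s tube is diffeomorphic to the surgery of `X_{φ ∘ F₁}` along the transported tube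
`Θ ∘ P.tubeFun` (`CircleNbhd.map`, `CircleNbhd.nonempty_diffeomorph_surgered_map`), a tubular
neighbourhood of `Θ ∘ c` — which is the section circle of `X_{φ ∘ F₁}` when `F` is based at `1`
and `φ 1 = 1` (`isotopyTransport_comp_secCircle`). [cite: GompfAGT2010, §4 ¶2 (X^{τ·σ}_ψ = X^σ_φ)] -/
theorem nonempty_diffeomorph_surgered_isotopyTransport (P : TubeTwistPair φ) :
    Nonempty (P.circleNbhd.Surgered ≃ₘ⟮𝓡 4, 𝓡 4⟯ (P.circleNbhd.map (isotopyTransport φ D)).Surgered) :=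
  P.circleNbhd.nonempty_diffeomorph_surgered_map (isotopyTransport φ D)

end Transport

/-! ### Copies of tubular neighbourhoods along equal core circles -/

namespace CircleNbhd

variable {X : Type u} [TopologicalSpace X] [ChartedSpace (𝔼 4) X] {c c' : 𝕊 1 → X}

/-- The same tube viewed as a tubular neighbourhood of a (propositionally) equal core circle. [folklore] -/
def copy (ν : CircleNbhd (𝓡 4) c) (h : c = c') : CircleNbhd (𝓡 4) c' where
  toFun := ν.toFun
  isSmoothEmbedding := ν.isSmoothEmbedding
  isOpen_range := ν.isOpen_range
  apply_zero u := h ▸ ν.apply_zero u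

/-- The copy has the same tube. [folklore] -/
@[simp] theorem copy_toFun (ν : CircleNbhd (𝓡 4) c) (h : c = c') : (ν.copy h).toFun = ν.toFun := rfl

/-- Copying along an equality of core circles does not change the surgery. [folklore] -/
theorem nonempty_diffeomorph_surgered_copy [T2Space X] [IsManifold (𝓡 4) ∞ X]
    (ν : CircleNbhd (𝓡 4) c) (h : c = c') :
    Nonempty (ν.Surgered ≃ₘ⟮𝓡 4, 𝓡 4⟯ (ν.copy h).Surgered) := by
  subst h
  exact ⟨Diffeomorph.refl _ _ _⟩

end CircleNbhd

/-! ### Compactly supported fibre reframings `sh_ε⁻¹ ∘ (c · Π l) ∘ sh_ε` (general radius) -/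

section ReframeFibre

variable {ε : ℝ} (hε : 0 < ε) (l : List (𝔼 3 →L[ℝ] 𝔼 3))
  (hl : ∀ L ∈ l, ‖L - 1‖ ≤ straightenThreshold (coreBump (E := 𝔼 3))) (c : ℝ)

/-- **The core diffeomorphism** `T = S_l ∘ D_c` of `GompfConjInvariance.lean` (`reframeCoreFun`) at a
general radius `ε`: `= c · Π l` on the core ball, the identity near and beyond the sphere of radius
`ε` (a choice from `exists_diffeomorph_reframeCoreFun`). [folklore] -/
def reframeCore : 𝔼 3 ≃ₘ⟮𝓘(ℝ, 𝔼 3), 𝓘(ℝ, 𝔼 3)⟯ 𝔼 3 :=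
  (exists_diffeomorph_reframeCoreFun hε l hl c).choose

/-- `T` as a function. [folklore] -/
theorem coe_reframeCore : ⇑(reframeCore hε l hl c) = reframeCoreFun hε l c :=
  (exists_diffeomorph_reframeCoreFun hε l hl c).choose_spec

/-- `T` is the identity near and beyond the sphere of radius `ε`. [folklore] -/
theorem reframeCore_of_le_norm (y : 𝔼 3) (hy : ε * (24 / 25) ≤ ‖y‖) : reframeCore hε l hl c y = y := by
  rw [coe_reframeCore]
  exact reframeCoreFun_of_le_norm _ _ _ hy

/-- **The fibre reframing `g = sh_ε⁻¹ ∘ T ∘ sh_ε`**, a diffeomorphism of `ℝ³`, the identity off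
`B(0, 7/2)`, fixing `0`. [cite: GompfStipsiczGSM1999, §5.2] -/
def reframeFibre : 𝔼 3 ≃ₘ⟮𝓘(ℝ, 𝔼 3), 𝓘(ℝ, 𝔼 3)⟯ 𝔼 3 :=
  ballConj hε (reframeCore hε l hl c) (reframeCore_of_le_norm hε l hl c)

/-- `g 0 = 0`. [folklore] -/
theorem reframeFibre_zero : reframeFibre hε l hl c 0 = 0 :=
  ballConj_apply_zero _ _ _ (by rw [coe_reframeCore, reframeCoreFun_apply_zero])

/-- `g` is the identity off `B(0, 7/2)`. [folklore] -/
theorem reframeFibre_of_le_norm {w : 𝔼 3} (hw : 7 / 2 ≤ ‖w‖) : reframeFibre hε l hl c w = w :=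
  ballConj_of_le_norm _ _ _ hw

/-- **The tube reparametrisation `(u, w) ↦ (u, g w)`.** [cite: GompfStipsiczGSM1999, §5.2] -/
def reframeTubeDiffeo : TubeDiffeo :=
  TubeDiffeo.ofFibre (reframeFibre hε l hl c) (7 / 2) (reframeFibre_zero hε l hl c)
    (fun _ hw ↦ reframeFibre_of_le_norm hε l hl c hw)

/-- The tube reparametrisation, pointwise. [folklore] -/
@[simp] theorem reframeTubeDiffeo_apply (u : 𝕊 1) (w : 𝔼 3) :
    (reframeTubeDiffeo hε l hl c).toDiffeomorph (u, w) = (u, reframeFibre hε l hl c w) :=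
  TubeDiffeo.ofFibre_apply _ _ _ _ u w

/-- **On the closed unit ball, `sh_ε (g w) = c · Π l (sh_ε w)`** (for `0 < c ≤ (6/7)^{|l|}` and factors
of norm `≤ 7/6`). [folklore] -/
theorem univBall_reframeFibre (hl' : ∀ L ∈ l, ‖L‖ ≤ 7 / 6) (hc : 0 < c)
    (hc1 : c ≤ (6 / 7 : ℝ) ^ l.length) {w : 𝔼 3} (hw : ‖w‖ ≤ 1) :
    univBall (0 : 𝔼 3) ε (reframeFibre hε l hl c w) = c • l.prod (univBall (0 : 𝔼 3) ε w) := by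
  rw [reframeFibre, univBall_ballConj_apply, coe_reframeCore,
    reframeCoreFun_of_norm_le hε hl' hc hc1 (norm_univBall_zero_le hε hw)]

/-- Factors within the straightening threshold of `GompfTubeMoves` (`fibreThreshold ≤ 1/6`) have
norm `≤ 7/6`. [folklore] -/
theorem norm_le_of_norm_sub_one_le_fibreThreshold {L : 𝔼 3 →L[ℝ] 𝔼 3}
    (hL : ‖L - 1‖ ≤ fibreThreshold) : ‖L‖ ≤ 7 / 6 := by
  have h1 : ‖L - 1‖ ≤ 1 / 6 := hL.trans (min_le_right _ _)
  have h2 : ‖(1 : 𝔼 3 →L[ℝ] 𝔼 3)‖ ≤ 1 := ContinuousLinearMap.norm_id_le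
  calc ‖L‖ = ‖(L - 1) + 1‖ := by rw [sub_add_cancel]
    _ ≤ ‖L - 1‖ + ‖(1 : 𝔼 3 →L[ℝ] 𝔼 3)‖ := norm_add_le _ _
    _ ≤ 7 / 6 := by linarith

end ReframeFibre

/-! ### Constant twisting data -/

section ConstMat

/-- **Constant twisting datum**: a fixed invertible matrix `N` (with its inverse `N⁻¹`) and a radius
`ε` with `3 K ε ≤ π` for an entry bound `K` of `N` (so that `N` maps the `ε`-ball into the cube
`(-π, π)³`). With `N = 1` this is the product tube; with `N = A` it is the image of a twisted tube
of `CSTorus A` under a straightening (`isotopyTransport_secNbhdFun_reframe` below). [folklore] -/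
def TubeTwist.constMat (N Ninv : Matrix (Fin 3) (Fin 3) ℝ) (h1 : N * Ninv = 1) (h2 : Ninv * N = 1)
    {ε K : ℝ} (hε : 0 < ε) (hK : ∀ i j, |N i j| ≤ K) (hKε : 3 * K * ε ≤ π) : TubeTwist where
  ε := ε
  ε_pos := hε
  mat _ := N
  inv _ := Ninv
  contDiff_mat _ _ := contDiff_const
  contDiff_inv _ _ := contDiff_const
  mat_mul_inv _ := h1
  inv_mul_mat _ := h2
  abs_lt_pi _ v hv i := by
    have hKnn : 0 ≤ K := (abs_nonneg _).trans (hK 0 0)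
    have h3 : |mulVecE N v i| ≤ 3 * K * ‖v‖ := by simpa using abs_mulVecE_apply_le hK v i
    rcases hKnn.eq_or_lt with hK0 | hKpos
    · have : |mulVecE N v i| ≤ 0 := by rw [← hK0] at h3; simpa using h3
      linarith [abs_nonneg (mulVecE N v i), Real.pi_pos]
    · have h4 : 3 * K * ‖v‖ < 3 * K * ε := mul_lt_mul_of_pos_left hv (by positivity)
      linarith

/-- The twisted exponential of a constant datum: `expT (N · univBall 0 ε w)`. [folklore] -/
theorem TubeTwist.texp_constMat (N Ninv : Matrix (Fin 3) (Fin 3) ℝ) (h1 : N * Ninv = 1)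
    (h2 : Ninv * N = 1) {ε K : ℝ} (hε : 0 < ε) (hK : ∀ i j, |N i j| ≤ K) (hKε : 3 * K * ε ≤ π)
    (s : ℝ) (w : 𝔼 3) :
    (TubeTwist.constMat N Ninv h1 h2 hε hK hKε).texp s w =
      expT (mulVecE N (univBall (0 : 𝔼 3) ε w)) := rfl

variable (ψ : ThreeTorus ≃ₘ⟮𝓣, 𝓣⟯ ThreeTorus) (N Ninv : Matrix (Fin 3) (Fin 3) ℝ) (h1 : N * Ninv = 1)
  (h2 : Ninv * N = 1) {ε K : ℝ} (hε : 0 < ε) (hK : ∀ i j, |N i j| ≤ K) (hKε : 3 * K * ε ≤ π)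

/-- **The constant pair** of matrix `N` on `X_ψ`, for a monodromy fixing the image tube pointwise:
`ψ (expT (N · univBall 0 ε w)) = expT (N · univBall 0 ε w)`. [folklore] -/
def constMatPair (hψ : ∀ w : 𝔼 3, ψ (expT (mulVecE N (univBall (0 : 𝔼 3) ε w))) =
      expT (mulVecE N (univBall (0 : 𝔼 3) ε w))) : TubeTwistPair ψ where
  DA := TubeTwist.constMat N Ninv h1 h2 hε hK hKε
  DB := TubeTwist.constMat N Ninv h1 h2 hε hK hKε
  texp_eq_of_le _ _ _ _ := rfl
  texp_eq_apply _ _ _ w := (hψ w).symm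

/-- The tube of the constant pair off `ptA`. [folklore] -/
theorem constMatPair_tubeFun_of_ne (hψ : ∀ w : 𝔼 3, ψ (expT (mulVecE N (univBall (0 : 𝔼 3) ε w))) =
      expT (mulVecE N (univBall (0 : 𝔼 3) ε w))) {u : 𝕊 1} (hu : u ≠ ptA) (w : 𝔼 3) :
    (constMatPair ψ N Ninv h1 h2 hε hK hKε hψ).tubeFun (u, w) =
      (mtGlueData ψ).inl (expT (mulVecE N (univBall (0 : 𝔼 3) ε w)), angAPt u) := by
  rw [TubeTwistPair.tubeFun_of_ne _ hu, TubeTwist.tubeA_apply]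
  rfl

/-- The tube of the constant pair at `ptA`. [folklore] -/
theorem constMatPair_tubeFun_ptA (hψ : ∀ w : 𝔼 3, ψ (expT (mulVecE N (univBall (0 : 𝔼 3) ε w))) =
      expT (mulVecE N (univBall (0 : 𝔼 3) ε w))) (w : 𝔼 3) :
    (constMatPair ψ N Ninv h1 h2 hε hK hKε hψ).tubeFun (ptA, w) =
      (mtGlueData ψ).inr (expT (mulVecE N (univBall (0 : 𝔼 3) ε w)), angBPt ptA) := by
  rw [TubeTwistPair.tubeFun_of_ne_ptB _ (show ((ptA, w) : (𝕊 1) × 𝔼 3).1 ≠ ptB from ptA_ne_ptB),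
    TubeTwist.tubeB_apply]
  rfl

end ConstMat

/-! ### Straightenings of a linear monodromy with exactly linear germs -/

/-- **A straightening of `A ∈ SL(3, ℤ)` with exactly linear germs.** A diffeotopy `F` of `T³` based
at `1` from the identity to a diffeomorphism `F₁` with `torusMap A ∘ F₁ = id` near `1`, whose
stages (and their inverses) are *exactly linear* in exponential coordinates on a cube around `0`:
`F_t (expT v) = expT (G_t v)`, `F_t⁻¹ (expT v) = expT (G_t⁻¹ v)` for `|vᵢ| < R`, with `G_0 = 1`,
`G_1 = A⁻¹`. The path `t ↦ G_t⁻¹` runs from `1` to `A` in `GL⁺(3, ℝ)`; read through the time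
profile of the re-gluing it is the framing path `Straightening.path` of the tube that the transport
`Θ_F` *untwists* (Gompf 2010, Def. 4.1 and §4 ¶2: a straightening of `A` is a homotopy class of
paths from `A` to `I`; "for each `σ` we straighten and then surger with the untwisted framing").
The constructions of the sequel produce such data with explicit `G`. [cite: GompfAGT2010, Def. 4.1 and §4 ¶2 (X^σ depends only on the straightening class σ)] -/
structure Straightening (A : Matrix.SpecialLinearGroup (Fin 3) ℤ) where
  /-- The based diffeotopy of `T³`. -/
  D : Diffeotopy 𝓣 ThreeTorus
  /-- Every stage fixes the base point `1`. -/
  based : ∀ t, D.toFun t 1 = 1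
  /-- The linear parts of the stages at `1`. -/
  G : ℝ → Matrix (Fin 3) (Fin 3) ℝ
  /-- The inverses of the linear parts. -/
  Ginv : ℝ → Matrix (Fin 3) (Fin 3) ℝ
  /-- The linear parts are smooth in `t`. -/
  contDiff_G : ∀ i j, ContDiff ℝ ∞ fun t ↦ G t i j
  /-- The inverse linear parts are smooth in `t`. -/
  contDiff_Ginv : ∀ i j, ContDiff ℝ ∞ fun t ↦ Ginv t i j
  /-- `G_t⁻¹` is a right inverse. -/
  G_mul_Ginv : ∀ t, G t * Ginv t = 1
  /-- `G_t⁻¹` is a left inverse. -/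
  Ginv_mul_G : ∀ t, Ginv t * G t = 1
  /-- The straightening starts at the identity. -/
  G_zero : G 0 = 1
  /-- The straightening ends at `A⁻¹` (so that `A ∘ F₁ = id` near `1`). -/
  G_one : G 1 = slRealMatrix A⁻¹
  /-- The size of the cube on which the stages are linear. -/
  R : ℝ
  /-- The cube is nondegenerate. -/
  R_pos : 0 < R
  /-- The stages are exactly linear on the cube. -/
  toFun_expT : ∀ t (v : 𝔼 3), (∀ i, |v i| < R) → D.toFun t (expT v) = expT (mulVecE (G t) v)
  /-- The inverse stages are exactly linear on the cube. -/
  invFun_expT : ∀ t (v : 𝔼 3), (∀ i, |v i| < R) → D.invFun t (expT v) = expT (mulVecE (Ginv t) v)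

namespace Straightening

variable {A : Matrix.SpecialLinearGroup (Fin 3) ℤ} (S : Straightening A)

/-- **The framing path of a straightening**: `θ ↦ G_{λ(θ/2)} · A`, from `G_1 A = 1` (`θ ≤ 0`) to
`G_0 A = A` (`θ ≥ 1`), `λ = isotopyProfile` the time profile of the re-gluing. This is the path `γ`
for which the transport `Θ_F` carries the `γ`-twisted tube of `CSTorus A` *exactly* onto a
constant tube of the straightened mapping torus (`isotopyTransport_secNbhdFun_reframe`). [cite: GompfAGT2010, Def. 4.1 and §4 ¶2 (X^σ depends only on the straightening class σ)] -/
def path : SmoothMatrixPath (slRealMatrix A) where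
  toFun θ := S.G (isotopyProfile (θ / 2)) * slRealMatrix A
  inv θ := slRealMatrix A⁻¹ * S.Ginv (isotopyProfile (θ / 2))
  contDiff_apply := SmoothMatrixPath.contDiff_mul_apply
    (fun i j ↦ (S.contDiff_G i j).comp (contDiff_isotopyProfile.comp (contDiff_id.div_const _)))
    fun _ _ ↦ contDiff_const
  contDiff_inv_apply := SmoothMatrixPath.contDiff_mul_apply (fun _ _ ↦ contDiff_const)
    fun i j ↦ (S.contDiff_Ginv i j).comp (contDiff_isotopyProfile.comp (contDiff_id.div_const _))
  mul_inv θ := by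
    rw [Matrix.mul_assoc, ← Matrix.mul_assoc (slRealMatrix A), slRealMatrix_mul_inv, Matrix.one_mul,
      S.G_mul_Ginv]
  inv_mul θ := by
    rw [Matrix.mul_assoc, ← Matrix.mul_assoc (S.Ginv _), S.Ginv_mul_G, Matrix.one_mul,
      slRealMatrix_inv_mul]
  eq_one θ hθ := by
    show S.G (isotopyProfile (θ / 2)) * slRealMatrix A = 1
    rw [isotopyProfile_of_le (by linarith), S.G_one, slRealMatrix_inv_mul]
  eq_self θ hθ := by
    show S.G (isotopyProfile (θ / 2)) * slRealMatrix A = slRealMatrix A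
    rw [isotopyProfile_of_ge (by linarith), S.G_zero, Matrix.one_mul]

/-- The framing path at `2 s` is `G_{λ s} A`. [folklore] -/
theorem path_toFun_two_mul (s : ℝ) : S.path.toFun (2 * s) = S.G (isotopyProfile s) * slRealMatrix A := by
  show S.G (isotopyProfile (2 * s / 2)) * slRealMatrix A = _
  rw [mul_div_cancel_left₀ s two_ne_zero]

/-- **The straightened monodromy** `ψ = A ∘ F₁` (the tree's `(F.stage 1).trans (torusDiffeomorph A)`),
which is the identity near `1`. [cite: GompfAGT2010, §4 ¶2 (X^{τ·σ}_ψ = X^σ_φ)] -/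
abbrev monodromy : ThreeTorus ≃ₘ⟮𝓣, 𝓣⟯ ThreeTorus := (S.D.stage 1).trans (torusDiffeomorph A)

/-- **The straightened monodromy is the identity on the cube**: `ψ (expT v) = expT v` for
`|vᵢ| < R`. [cite: GompfAGT2010, §2 (definition of X_φ and X_φ^ε)] -/
theorem monodromy_expT (v : 𝔼 3) (hv : ∀ i, |v i| < S.R) : S.monodromy (expT v) = expT v := by
  rw [Diffeomorph.coe_trans, comp_apply, Diffeotopy.coe_stage, S.toFun_expT 1 v hv, S.G_one,
    coe_torusDiffeomorph, torusMap_expT', mulVecE_mulVecE, slRealMatrix_mul_inv, mulVecE_one]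

/-- The straightened monodromy fixes `1`. [folklore] -/
theorem monodromy_one : S.monodromy 1 = 1 := by
  have h := S.monodromy_expT 0 fun i ↦ by simpa using S.R_pos
  rwa [expT_zero] at h

end Straightening

/-! ### Entry bounds along the framing path of a straightening -/

section Bounds

variable (A : Matrix.SpecialLinearGroup (Fin 3) ℤ) (γ : SmoothMatrixPath (slRealMatrix A))

/-- `twistBound ≥ 3`. [folklore] -/
theorem twistBound_three_le : 3 ≤ twistBound A γ := by
  have h2 := entryBound_nonneg (slRealMatrix A)
  have h3 := γ.bound_nonneg
  rw [twistBound]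
  nlinarith

/-- The entries of `A` are bounded by `twistBound`. [folklore] -/
theorem abs_slRealMatrix_le_twistBound (i j : Fin 3) : |slRealMatrix A i j| ≤ twistBound A γ := by
  have h1 := abs_le_entryBound (slRealMatrix A) i j
  have h2 := entryBound_nonneg (slRealMatrix A)
  have h3 := γ.bound_nonneg
  rw [twistBound]
  nlinarith

/-- `3 · twistBound · twistRadius < π`. [folklore] -/
theorem three_mul_twistBound_mul_twistRadius_lt_pi : 3 * twistBound A γ * twistRadius A γ < π := by
  have hK := twistBound_nonneg A γ
  have hπ := Real.pi_pos
  rw [twistRadius, mul_div_assoc', div_lt_iff₀ (by positivity)]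
  nlinarith

/-- `twistRadius ≤ π`. [folklore] -/
theorem twistRadius_le_pi : twistRadius A γ ≤ π := by
  have hK := twistBound_nonneg A γ
  have hπ := Real.pi_pos
  rw [twistRadius, div_le_iff₀ (by positivity)]
  nlinarith

/-- **Cube bound at a shrunk radius**: a matrix with entries bounded by `twistBound` maps vectors of
norm `≤ c · twistRadius` into the cube of half-width `c π` (`c > 0`). [folklore] -/
theorem abs_mulVecE_lt_of_norm_le {M : Matrix (Fin 3) (Fin 3) ℝ} (hM : ∀ i j, |M i j| ≤ twistBound A γ)
    {c : ℝ} (hc : 0 < c) (v : 𝔼 3) (hv : ‖v‖ ≤ c * twistRadius A γ) (i : Fin 3) :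
    |mulVecE M v i| < c * π := by
  have hK := twistBound_nonneg A γ
  have h1 : |mulVecE M v i| ≤ 3 * twistBound A γ * ‖v‖ := by simpa using abs_mulVecE_apply_le hM v i
  have h2 : 3 * twistBound A γ * ‖v‖ ≤ 3 * twistBound A γ * (c * twistRadius A γ) :=
    mul_le_mul_of_nonneg_left hv (by positivity)
  have h3 : 3 * twistBound A γ * (c * twistRadius A γ) < c * π := by
    have := three_mul_twistBound_mul_twistRadius_lt_pi A γ
    nlinarith
  linarith

end Bounds

/-! ### The transport of the twisted tube of `CSTorus A` under a straightening -/

section TransportTube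

variable {A : Matrix.SpecialLinearGroup (Fin 3) ℤ} (S : Straightening A)

/-- **The scale `c := min (R/π) 1`** at which the transported tube is read (small enough for all
vectors met to stay in the cube of linearity). [folklore] -/
def Straightening.scale : ℝ := min (S.R / π) 1

/-- `c > 0`. [folklore] -/
theorem Straightening.scale_pos : 0 < S.scale := lt_min (div_pos S.R_pos Real.pi_pos) one_pos

/-- `c ≤ 1`. [folklore] -/
theorem Straightening.scale_le_one : S.scale ≤ 1 := min_le_right _ _

/-- `c π ≤ R`. [folklore] -/
theorem Straightening.scale_mul_pi_le : S.scale * π ≤ S.R := by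
  have h := min_le_left (S.R / π) 1
  have hπ := Real.pi_pos
  calc S.scale * π ≤ S.R / π * π := mul_le_mul_of_nonneg_right h hπ.le
    _ = S.R := div_mul_cancel₀ _ hπ.ne'

/-- The radius `ε = twistRadius A S.path` of the twisted tube. [folklore] -/
abbrev Straightening.rad : ℝ := twistRadius A S.path

/-- **The shrinking reparametrisation** `(u, w) ↦ (u, sh_ε⁻¹ (c · sh_ε w))` of the twisted tube
(`reframeTubeDiffeo` with the empty list). [folklore] -/
def Straightening.shrinkTubeDiffeo : TubeDiffeo :=
  reframeTubeDiffeo (twistRadius_pos A S.path) [] (fun _ h ↦ absurd h List.not_mem_nil) S.scale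

/-- On the closed unit ball the shrinking reparametrisation multiplies `sh_ε` by `c`. [folklore] -/
theorem Straightening.shrink_shrinkFibre {w : 𝔼 3} (hw : ‖w‖ ≤ 1) :
    (twistA A S.path).shrink ((S.shrinkTubeDiffeo.toDiffeomorph (ptA, w)).2) =
      S.scale • (twistA A S.path).shrink w := by
  rw [Straightening.shrinkTubeDiffeo, reframeTubeDiffeo_apply]
  show univBall (0 : 𝔼 3) (twistRadius A S.path) _ = S.scale • univBall (0 : 𝔼 3) (twistRadius A S.path) w
  rw [univBall_reframeFibre _ _ _ _ (fun _ h ↦ absurd h List.not_mem_nil) S.scale_pos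
    (by rw [List.length_nil, pow_zero]; exact S.scale_le_one) hw, List.prod_nil,
    one_apply_eq_self]

/-- The shrinking reparametrisation is fibrewise (its first component is the identity and its
second component does not depend on the point of the circle). [folklore] -/
theorem Straightening.shrinkTubeDiffeo_apply (u : 𝕊 1) (w : 𝔼 3) :
    S.shrinkTubeDiffeo.toDiffeomorph (u, w) = (u, (S.shrinkTubeDiffeo.toDiffeomorph (ptA, w)).2) := by
  rw [Straightening.shrinkTubeDiffeo, reframeTubeDiffeo_apply, reframeTubeDiffeo_apply]

/-- The entry bound `3 K (c ε) ≤ π` for the constant datum of matrix `A` at radius `c ε`. [folklore] -/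
theorem Straightening.three_mul_le_pi :
    3 * twistBound A S.path * (S.scale * twistRadius A S.path) ≤ π := by
  have h1 := three_mul_twistBound_mul_twistRadius_lt_pi A S.path
  have hK := twistBound_nonneg A S.path
  have h4 : S.scale * twistRadius A S.path ≤ twistRadius A S.path :=
    mul_le_of_le_one_left (twistRadius_pos A S.path).le S.scale_le_one
  have h5 : 3 * twistBound A S.path * (S.scale * twistRadius A S.path) ≤
      3 * twistBound A S.path * twistRadius A S.path := mul_le_mul_of_nonneg_left h4 (by positivity)
  linarith

/-- **The straightened monodromy fixes the constant-`A` tube of radius `c ε` pointwise**: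
`ψ (expT (A · sh_{cε} w)) = expT (A · sh_{cε} w)`. [folklore] -/
theorem Straightening.monodromy_expT_constA (w : 𝔼 3) :
    S.monodromy (expT (mulVecE (slRealMatrix A)
      (univBall (0 : 𝔼 3) (S.scale * twistRadius A S.path) w))) =
      expT (mulVecE (slRealMatrix A) (univBall (0 : 𝔼 3) (S.scale * twistRadius A S.path) w)) := by
  refine S.monodromy_expT _ fun i ↦ lt_of_lt_of_le ?_ S.scale_mul_pi_le
  exact abs_mulVecE_lt_of_norm_le A S.path (abs_slRealMatrix_le_twistBound A S.path) S.scale_pos _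
    (norm_univBall_zero_lt (mul_pos S.scale_pos (twistRadius_pos A S.path)) w).le i

/-- **The constant-`A` pair on the straightened mapping torus** at radius `c ε`: the image of the
twisted tube of `CSTorus A` under the transport (`isotopyTransport_secNbhdFun_reframe`). [folklore] -/
def Straightening.constAPair : TubeTwistPair S.monodromy :=
  constMatPair S.monodromy (slRealMatrix A) (slRealMatrix A⁻¹) (slRealMatrix_mul_inv A)
    (slRealMatrix_inv_mul A) (mul_pos S.scale_pos (twistRadius_pos A S.path))
    (abs_slRealMatrix_le_twistBound A S.path) S.three_mul_le_pi S.monodromy_expT_constA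

/-- `sh_{cε} = c · sh_ε`. [folklore] -/
theorem Straightening.univBall_scale_mul (w : 𝔼 3) :
    univBall (0 : 𝔼 3) (S.scale * twistRadius A S.path) w =
      S.scale • (twistA A S.path).shrink w := by
  show _ = S.scale • univBall (0 : 𝔼 3) (twistRadius A S.path) w
  rw [univBall_zero_eq_smul (mul_pos S.scale_pos (twistRadius_pos A S.path)),
    univBall_zero_eq_smul (twistRadius_pos A S.path), smul_smul, smul_smul, smul_smul, mul_assoc]

/-- **The transport computation.** The transport `Θ_F : CSTorus A ≅ X_ψ` of the straightening maps
the twisted tube `ν_γ` of `CSTorus A` (`γ = S.path`), precomposed with the shrinking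
reparametrisation, onto the constant-`A` tube of `X_ψ` of radius `c ε` — on the closed unit ball
bundle: off `ptA`, `Θ [expT (G_{λ s} A · c sh_ε w), s] = [F_{λ s}⁻¹ (…), s] = [expT (A · c sh_ε w), s]`
by exact linearity of `F_{λ s}⁻¹` on the cube; at `ptA` (level `1`, where the re-gluing is trivial)
both sides are `[expT (A · c sh_ε w), 1]`. [cite: GompfAGT2010, §4 ¶2 (X^{τ·σ}_ψ = X^σ_φ)] -/
theorem isotopyTransport_secNbhdFun_reframe (u : 𝕊 1) {w : 𝔼 3} (hw : ‖w‖ ≤ 1) :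
    isotopyTransport (torusDiffeomorph A) S.D
        (secNbhdFun A S.path (S.shrinkTubeDiffeo.toDiffeomorph (u, w))) =
      S.constAPair.tubeFun (u, w) := by
  have hsh : (twistA A S.path).shrink (S.shrinkTubeDiffeo.toDiffeomorph (ptA, w)).2 =
      S.scale • (twistA A S.path).shrink w := S.shrink_shrinkFibre hw
  rw [S.shrinkTubeDiffeo_apply u w]
  by_cases hu : u = ptA
  · subst hu
    have hL : isotopyTransport (torusDiffeomorph A) S.D
        (secNbhdFun A S.path (ptA, (S.shrinkTubeDiffeo.toDiffeomorph (ptA, w)).2)) =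
        (mtGlueData S.monodromy).inr
          (expT (mulVecE (slRealMatrix A) (S.scale • (twistA A S.path).shrink w)), angBPt ptA) := by
      rw [secNbhdFun_of_ne_ptB A S.path ptA_ne_ptB, TubeTwist.tubeB_apply, isotopyTransport_inr]
      dsimp only
      rw [coe_angBPt_ptA, sub_self, isotopyProfile_of_le (by norm_num : (0 : ℝ) ≤ 1 / 4),
        S.D.toFun_invFun, Diffeomorph.apply_symm_apply, texp_twistB_of_le A S.path le_rfl, hsh]
    have hR : S.constAPair.tubeFun (ptA, w) = (mtGlueData S.monodromy).inr
        (expT (mulVecE (slRealMatrix A) (S.scale • (twistA A S.path).shrink w)), angBPt ptA) := by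
      rw [Straightening.constAPair, constMatPair_tubeFun_ptA, S.univBall_scale_mul]
    rw [hL, hR]
  · have hcube : ∀ i, |mulVecE (S.G (isotopyProfile (angAPt u : ℝ)) * slRealMatrix A)
        (S.scale • (twistA A S.path).shrink w) i| < S.R := by
      intro i
      refine lt_of_lt_of_le ?_ S.scale_mul_pi_le
      have hbd : ∀ i j, |(S.G (isotopyProfile (angAPt u : ℝ)) * slRealMatrix A) i j| ≤
          twistBound A S.path := fun i j ↦ by
        rw [← S.path_toFun_two_mul]
        exact abs_path_le_twistBound A S.path _ i j
      refine abs_mulVecE_lt_of_norm_le A S.path hbd S.scale_pos _ ?_ i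
      rw [norm_smul, Real.norm_of_nonneg S.scale_pos.le]
      exact mul_le_mul_of_nonneg_left ((twistA A S.path).norm_shrink_lt w).le S.scale_pos.le
    have hL : isotopyTransport (torusDiffeomorph A) S.D
        (secNbhdFun A S.path (u, (S.shrinkTubeDiffeo.toDiffeomorph (ptA, w)).2)) =
        (mtGlueData S.monodromy).inl
          (expT (mulVecE (slRealMatrix A) (S.scale • (twistA A S.path).shrink w)), angAPt u) := by
      rw [secNbhdFun_of_ne A S.path (p := (u, (S.shrinkTubeDiffeo.toDiffeomorph (ptA, w)).2)) hu,
        TubeTwist.tubeA_apply, isotopyTransport_inl]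
      dsimp only
      have htexp : (twistA A S.path).texp (angAPt u) (S.shrinkTubeDiffeo.toDiffeomorph (ptA, w)).2 =
          expT (mulVecE (S.G (isotopyProfile (angAPt u : ℝ)) * slRealMatrix A)
            (S.scale • (twistA A S.path).shrink w)) := by
        show expT (mulVecE (S.path.toFun (2 * (angAPt u : ℝ))) ((twistA A S.path).shrink _)) = _
        rw [hsh, S.path_toFun_two_mul]
      rw [htexp, S.invFun_expT _ _ hcube, mulVecE_mulVecE, ← Matrix.mul_assoc, S.Ginv_mul_G,
        Matrix.one_mul]
    have hR : S.constAPair.tubeFun (u, w) = (mtGlueData S.monodromy).inl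
        (expT (mulVecE (slRealMatrix A) (S.scale • (twistA A S.path).shrink w)), angAPt u) := by
      rw [Straightening.constAPair, constMatPair_tubeFun_of_ne _ _ _ _ _ _ _ _ _ hu, S.univBall_scale_mul]
    rw [hL, hR]

end TransportTube


/-! ### Assembly: `gompfSphere A S.path` is the product-framed surgery of the straightened torus -/

section Assembly

/-- `univBall 0 (a ε) = a · univBall 0 ε` for `a, ε > 0` (`univBall 0 r w = r w / √(1 + ‖w‖²)`). [folklore] -/
theorem univBall_zero_mul {a ε : ℝ} (ha : 0 < a) (hε : 0 < ε) (w : 𝔼 3) :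
    univBall (0 : 𝔼 3) (a * ε) w = a • univBall (0 : 𝔼 3) ε w := by
  rw [univBall_zero_eq_smul (mul_pos ha hε), univBall_zero_eq_smul hε, smul_smul, smul_smul, smul_smul,
    mul_assoc]

variable {A : Matrix.SpecialLinearGroup (Fin 3) ℤ} (S : Straightening A)

/-- **Step 1: `gompfSphere A S.path ≅` the surgery of `X_ψ` along the constant-`A` tube.**
Transport along `Θ_F` (`CircleNbhd.nonempty_diffeomorph_surgered_map`), then the transported tube
agrees on the unit ball bundle, after the shrinking reparametrisation, with the constant-`A` tube
(`isotopyTransport_secNbhdFun_reframe`, `CircleNbhd.nonempty_diffeomorph_surgered_of_eqOn_twist`),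
both being tubes of the section circle of `X_ψ` (`isotopyTransport_comp_secCircle`). [cite: GompfAGT2010, §4 ¶2 (X^{τ·σ}_ψ = X^σ_φ)] -/
theorem Straightening.nonempty_diffeomorph_gompfSphere_constA :
    Nonempty (gompfSphere A S.path ≃ₘ⟮𝓡 4, 𝓡 4⟯ S.constAPair.circleNbhd.Surgered) := by
  set Θ := isotopyTransport (torusDiffeomorph A) S.D with hΘ
  have hsec : S.constAPair.secCircle = ⇑Θ ∘ sectionCircle A S.path := by
    rw [← TubeTwistPair.secCircle_twistPair A S.path, hΘ,
      isotopyTransport_comp_secCircle (torusDiffeomorph A) S.D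
        (by rw [coe_torusDiffeomorph, torusMap_apply_one]) S.based (twistPair A S.path) S.constAPair]
  have e1 := (sectionCircleNbhd A S.path).nonempty_diffeomorph_surgered_map Θ
  have e2 : Nonempty (((sectionCircleNbhd A S.path).map Θ).Surgered ≃ₘ⟮𝓡 4, 𝓡 4⟯
      (S.constAPair.circleNbhd.copy hsec).Surgered) := by
    refine ((sectionCircleNbhd A S.path).map Θ).nonempty_diffeomorph_surgered_of_eqOn_twist
      S.shrinkTubeDiffeo _ fun u w hw ↦ ?_
    rw [CircleNbhd.copy_toFun, TubeTwistPair.circleNbhd_toFun, CircleNbhd.map_apply]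
    exact (isotopyTransport_secNbhdFun_reframe S u hw.le).symm
  have e3 := S.constAPair.circleNbhd.nonempty_diffeomorph_surgered_copy hsec
  obtain ⟨e1⟩ := e1
  obtain ⟨e2⟩ := e2
  obtain ⟨e3⟩ := e3
  exact ⟨e1.trans (e2.trans e3.symm)⟩

/-- **The near-identity factors of `A⁻¹`** (operators within `fibreThreshold` of the identity with
product `A⁻¹`, from a path in `GL⁺(3, ℝ)`; `exists_list_prod_eq_matCLM`). [folklore] -/
def straightenInvFactors (A : Matrix.SpecialLinearGroup (Fin 3) ℤ) : List (𝔼 3 →L[ℝ] 𝔼 3) :=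
  (exists_list_prod_eq_matCLM A⁻¹ fibreThreshold_pos).choose

/-- The factors are within the threshold. [folklore] -/
theorem norm_sub_one_le_of_mem_straightenInvFactors (A : Matrix.SpecialLinearGroup (Fin 3) ℤ)
    {L : 𝔼 3 →L[ℝ] 𝔼 3} (hL : L ∈ straightenInvFactors A) : ‖L - 1‖ ≤ fibreThreshold :=
  (exists_list_prod_eq_matCLM A⁻¹ fibreThreshold_pos).choose_spec.1 L hL

/-- The product of the factors is `A⁻¹`. [folklore] -/
theorem prod_straightenInvFactors (A : Matrix.SpecialLinearGroup (Fin 3) ℤ) :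
    (straightenInvFactors A).prod = matCLM (slRealMatrix A⁻¹) :=
  (exists_list_prod_eq_matCLM A⁻¹ fibreThreshold_pos).choose_spec.2

/-- **The second scale `c' := (6/7)^{|l|}`.** [folklore] -/
def straightenScale' (A : Matrix.SpecialLinearGroup (Fin 3) ℤ) : ℝ :=
  (6 / 7 : ℝ) ^ (straightenInvFactors A).length

/-- `c' > 0`. [folklore] -/
theorem straightenScale'_pos (A : Matrix.SpecialLinearGroup (Fin 3) ℤ) : 0 < straightenScale' A := by
  unfold straightenScale'; positivity

/-- `c' ≤ 1`. [folklore] -/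
theorem straightenScale'_le_one (A : Matrix.SpecialLinearGroup (Fin 3) ℤ) : straightenScale' A ≤ 1 :=
  pow_le_one₀ (by norm_num) (by norm_num)

/-- **The radius `ε₁ := c' c ε` of the product tube.** [folklore] -/
def Straightening.prodRad : ℝ := straightenScale' A * (S.scale * twistRadius A S.path)

/-- `ε₁ > 0`. [folklore] -/
theorem Straightening.prodRad_pos : 0 < S.prodRad :=
  mul_pos (straightenScale'_pos A) (mul_pos S.scale_pos (twistRadius_pos A S.path))

/-- `ε₁ ≤ c π` (`≤ R`, `≤ π`). [folklore] -/
theorem Straightening.prodRad_le : S.prodRad ≤ S.scale * π := by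
  have h1 : S.scale * twistRadius A S.path ≤ S.scale * π :=
    mul_le_mul_of_nonneg_left (twistRadius_le_pi A S.path) S.scale_pos.le
  have h2 : S.prodRad ≤ S.scale * twistRadius A S.path :=
    mul_le_of_le_one_left (mul_pos S.scale_pos (twistRadius_pos A S.path)).le (straightenScale'_le_one A)
  exact h2.trans h1

/-- `ε₁ ≤ π`. [folklore] -/
theorem Straightening.prodRad_le_pi : S.prodRad ≤ π :=
  S.prodRad_le.trans (mul_le_of_le_one_left Real.pi_pos.le S.scale_le_one)

/-- **The straightened monodromy is the identity on `expT (B(0, ε₁))`.** [cite: GompfAGT2010, §2 (definition of X_φ and X_φ^ε)] -/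
theorem Straightening.monodromy_expT_of_norm_lt (v : 𝔼 3) (hv : ‖v‖ < S.prodRad) :
    S.monodromy (expT v) = expT v := by
  refine S.monodromy_expT v fun i ↦ ?_
  have h1 : |v i| ≤ ‖v‖ := (Real.norm_eq_abs _).symm.le.trans (PiLp.norm_apply_le v i)
  linarith [S.prodRad_le, S.scale_mul_pi_le]

/-- **Gompf's `X^σ_A` as a product-framed surgery**: the straightened mapping torus of `ψ = A ∘ F₁`
surgered along its section circle with the canonical framing of radius `ε₁`. [cite: GompfAGT2010, §4 ¶2 (X^{τ·σ}_ψ = X^σ_φ)] -/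
abbrev Straightening.prodSphere : Type :=
  prodSurgered S.monodromy S.prodRad S.prodRad_pos S.prodRad_le_pi S.monodromy_expT_of_norm_lt

/-- The reframing of the constant-`A` tube by `c' A⁻¹` on the fibres. [folklore] -/
def Straightening.unframeTubeDiffeo : TubeDiffeo :=
  reframeTubeDiffeo (mul_pos S.scale_pos (twistRadius_pos A S.path)) (straightenInvFactors A)
    (fun _ hL ↦ (norm_sub_one_le_of_mem_straightenInvFactors A hL).trans (min_le_left _ _))
    (straightenScale' A)

/-- **On the closed unit ball, the constant-`A` tube reframed by `c' A⁻¹` is the product tube of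
radius `ε₁`**: `A · sh_{cε} (g' w) = A · c' A⁻¹ sh_{cε} w = sh_{ε₁} w`. [folklore] -/
theorem Straightening.constAPair_tubeFun_unframe (u : 𝕊 1) {w : 𝔼 3} (hw : ‖w‖ ≤ 1) :
    S.constAPair.tubeFun (S.unframeTubeDiffeo.toDiffeomorph (u, w)) =
      (prodTube S.monodromy S.prodRad S.prodRad_pos S.prodRad_le_pi S.monodromy_expT_of_norm_lt).toFun
        (u, w) := by
  have hcε := mul_pos S.scale_pos (twistRadius_pos A S.path)
  have key : mulVecE (slRealMatrix A) (univBall (0 : 𝔼 3) (S.scale * twistRadius A S.path)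
      ((S.unframeTubeDiffeo.toDiffeomorph (u, w)).2)) = univBall (0 : 𝔼 3) S.prodRad w := by
    rw [Straightening.unframeTubeDiffeo, reframeTubeDiffeo_apply]
    dsimp only
    rw [univBall_reframeFibre hcε _ _ _ (fun L hL ↦ norm_le_of_norm_sub_one_le_fibreThreshold
        (norm_sub_one_le_of_mem_straightenInvFactors A hL)) (straightenScale'_pos A) le_rfl hw,
      prod_straightenInvFactors, matCLM_apply, ← mulVecE_smul, mulVecE_mulVecE, slRealMatrix_mul_inv,
      mulVecE_one, Straightening.prodRad, univBall_zero_mul (straightenScale'_pos A) hcε]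
  have hfst : (S.unframeTubeDiffeo.toDiffeomorph (u, w)).1 = u := by
    rw [Straightening.unframeTubeDiffeo, reframeTubeDiffeo_apply]
  by_cases hu : u = ptA
  · subst hu
    have h1 : S.unframeTubeDiffeo.toDiffeomorph (ptA, w) = (ptA, (S.unframeTubeDiffeo.toDiffeomorph (ptA, w)).2) :=
      Prod.ext hfst rfl
    rw [h1, Straightening.constAPair, constMatPair_tubeFun_ptA, key]
    exact (prodTube_apply_of_ne_ptB S.monodromy S.prodRad S.prodRad_pos S.prodRad_le_pi
      S.monodromy_expT_of_norm_lt ptA_ne_ptB w).symm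
  · have h1 : S.unframeTubeDiffeo.toDiffeomorph (u, w) = (u, (S.unframeTubeDiffeo.toDiffeomorph (u, w)).2) :=
      Prod.ext hfst rfl
    rw [h1, Straightening.constAPair, constMatPair_tubeFun_of_ne _ _ _ _ _ _ _ _ _ hu, key]
    exact (prodTube_apply_of_ne S.monodromy S.prodRad S.prodRad_pos S.prodRad_le_pi
      S.monodromy_expT_of_norm_lt hu w).symm

/-- **Step 2: the constant-`A` surgery is the product surgery** (reparametrise the tube by the
compactly supported fibre map `sh⁻¹ ∘ (c' A⁻¹) ∘ sh`, `CircleNbhd.nonempty_diffeomorph_surgered_of_eqOn_twist`). [cite: GompfStipsiczGSM1999, §5.2] -/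
theorem Straightening.nonempty_diffeomorph_constA_prodSphere :
    Nonempty (S.constAPair.circleNbhd.Surgered ≃ₘ⟮𝓡 4, 𝓡 4⟯ S.prodSphere) := by
  have hsec : (prodPair S.monodromy S.prodRad S.prodRad_pos S.prodRad_le_pi
      S.monodromy_expT_of_norm_lt).secCircle = S.constAPair.secCircle :=
    TubeTwistPair.secCircle_eq _ _
  have e1 : Nonempty (S.constAPair.circleNbhd.Surgered ≃ₘ⟮𝓡 4, 𝓡 4⟯
      ((prodTube S.monodromy S.prodRad S.prodRad_pos S.prodRad_le_pi
        S.monodromy_expT_of_norm_lt).copy hsec).Surgered) := by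
    refine S.constAPair.circleNbhd.nonempty_diffeomorph_surgered_of_eqOn_twist S.unframeTubeDiffeo _
      fun u w hw ↦ ?_
    rw [CircleNbhd.copy_toFun, TubeTwistPair.circleNbhd_toFun]
    exact (S.constAPair_tubeFun_unframe u hw.le).symm
  have e2 := (prodTube S.monodromy S.prodRad S.prodRad_pos S.prodRad_le_pi
    S.monodromy_expT_of_norm_lt).nonempty_diffeomorph_surgered_copy hsec
  obtain ⟨e1⟩ := e1
  obtain ⟨e2⟩ := e2
  exact ⟨e1.trans e2.symm⟩

/-- **Gompf's "`X^{τ·σ}_ψ = X^σ_φ`" for a straightening with exactly linear germs** (§4 ¶2: "for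
any straightening `σ` of the derivative … there is an isotopy `φ_t` rel `p` for which `φ_1` fixes
a neighborhood of `p` and `d(φ_t)_p` represents `σ` … the two straightenings `σ` … canonically
determine the two possible isotopy classes … of monodromies … and hence the two resulting
diffeomorphism types, which we denote by `X^σ_{φ_0}`. (For each `σ` we straighten and then surger
with the untwisted framing.)"). On the tree's concrete objects: for `A ∈ SL(3, ℤ)` and a based
diffeotopy `F` of `T³` straightening `torusMap A` to the identity near `1` with exactly linear
germs `G_t` (`Straightening`), the framed Cappell–Shaneson sphere `gompfSphere A γ` of the framing
path `γ = S.path : θ ↦ G_{λ(θ/2)} A` is diffeomorphic to the *product-framed* surgery of the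
straightened mapping torus `X_{A ∘ F₁}` (`Straightening.prodSphere`). By
`gompf2010_straightening_invariance_holds` (W) the same holds for every `γ` in the straightening
class `[S.path]`. [cite: GompfAGT2010, §4 ¶2 (X^{τ·σ}_ψ = X^σ_φ)] -/
theorem Straightening.nonempty_diffeomorph_gompfSphere_prodSphere :
    Nonempty (gompfSphere A S.path ≃ₘ⟮𝓡 4, 𝓡 4⟯ S.prodSphere) :=
  nonempty_diffeomorph_trans S.nonempty_diffeomorph_gompfSphere_constA
    S.nonempty_diffeomorph_constA_prodSphere

/-- **The same for any framing path in the straightening class of `S.path`** (W,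
`gompf2010_straightening_invariance_holds`). [cite: GompfAGT2010, Def. 4.1 and §4 ¶2 (X^σ depends only on the straightening class σ)] -/
theorem Straightening.nonempty_diffeomorph_gompfSphere_prodSphere_of_homotopic
    (γ : SmoothMatrixPath (slRealMatrix A)) (hγ : γ.toPath.Homotopic S.path.toPath) :
    Nonempty (gompfSphere A γ ≃ₘ⟮𝓡 4, 𝓡 4⟯ S.prodSphere) :=
  nonempty_diffeomorph_trans (gompf2010_straightening_invariance_holds A γ S.path hγ)
    S.nonempty_diffeomorph_gompfSphere_prodSphere

end Assembly

end Literature.Topology.FourManifolds
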